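import Summits.RiemannHypothesis.RiemannHypothesis.Theorems.WeilFormatCDataA1FrontData
import Summits.RiemannHypothesis.RiemannHypothesis.Theorems.FormatCPsdBands
import HarnessLib

/-!
# Format C kernel rung `A1` (a = 1/1, column-band layout): even sector (P): dyadic-Cholesky row budgets, rows 0…95 (kernel certificates)

Window `a = 1/1`; prime powers in the window: 2, 3, 2^2, 5, 7; prime constant A = 2027/1000 (`WeilFormatC.primeCoeff_form_ge_cells_one_v2`); evaluator parameters S = 2^256, Kpi 130, Kser 150, kred 8, Kexp 45, J 120; full table modes < 161; light column table modes < 1027; units 2^-250 (Schur entries), 2^-124 (column digits, width 127), 2^-118 (tail-factor digits, width 121), 2^-64 (reciprocal weights), 2^-40 (tail base); order-J tail J = 4, θ = 1/2048, η = 1/10 | 4/1.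
Design row: weil-2 gen6 candidate (HOME INBOX l.2038): EVEN 160/512 MS-tail, ODD 160/1024 MS-tail; sizing lineage PRODUCTION-TABLE v2.1 bb57741022c05245. Generated by rh-explicit-weil-2 gen7 (gen7/gramgen7.py sha16 8036b365e32639e1) from `#eval` of the tree's `Encl` functions; every datum is re-verified by the kernel in the theorem files (`decide +kernel`). Helper data of the rh-explicit Weil-positivity programme (format C, K-CELL-2), RH-free. [cite: Yoshida1992HermitianForms, §5 (5.15)-(5.16) p. 301; §7 pp. 305–312]
-/

set_option linter.dupNamespace false
set_option maxRecDepth 200000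

namespace Summit.RiemannHypothesis.RiemannHypothesis.Theorems.WeilFormatCData.A1CBEven

open Literature.NumberTheory.LFunctions Literature.NumberTheory.LFunctions.PsdDyadic Summit.RiemannHypothesis.RiemannHypothesis.Theorems.FormatCPsd

/-- kernel: (P) row budgets `[0, 12)` (radius = the Schur radius `rho`). -/
theorem tPB0 : checkPsdBand δ rho DS L 0 12 = true := by decide +kernel

/-- kernel: (P) row budgets `[12, 24)` (radius = the Schur radius `rho`). -/
theorem tPB12 : checkPsdBand δ rho DS L 12 12 = true := by decide +kernel

/-- kernel: (P) row budgets `[24, 36)` (radius = the Schur radius `rho`). -/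
theorem tPB24 : checkPsdBand δ rho DS L 24 12 = true := by decide +kernel

/-- kernel: (P) row budgets `[36, 48)` (radius = the Schur radius `rho`). -/
theorem tPB36 : checkPsdBand δ rho DS L 36 12 = true := by decide +kernel

/-- kernel: (P) row budgets `[48, 60)` (radius = the Schur radius `rho`). -/
theorem tPB48 : checkPsdBand δ rho DS L 48 12 = true := by decide +kernel

/-- kernel: (P) row budgets `[60, 72)` (radius = the Schur radius `rho`). -/
theorem tPB60 : checkPsdBand δ rho DS L 60 12 = true := by decide +kernel

/-- kernel: (P) row budgets `[72, 84)` (radius = the Schur radius `rho`). -/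
theorem tPB72 : checkPsdBand δ rho DS L 72 12 = true := by decide +kernel

/-- kernel: (P) row budgets `[84, 96)` (radius = the Schur radius `rho`). -/
theorem tPB84 : checkPsdBand δ rho DS L 84 12 = true := by decide +kernel

end Summit.RiemannHypothesis.RiemannHypothesis.Theorems.WeilFormatCData.A1CBEven
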